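import Summits.CriticalPhenomena.PercolationContinuityZ3.Theorems.Transplant.HeisenbergSymmetricGensContinuity
import Summits.CriticalPhenomena.PercolationContinuityZ3.Theorems.Transplant.SkelConcHolds
import HarnessLib

/-!
# `θ(p_c) = 0` on every `D₄`-symmetric unit-step Cayley graph of `H₃(ℤ)` — UNCONDITIONAL (part 3: the node of record
# `samePDropOfSkeletonConcLt_holds` plugged into part 2's `HeisGens.criticalContinuity_of_skeletonConcNode'`)

builds on p205010 (kernel theorem, internal audit signed; external expert review pending) — through `SkelConcHolds` (the general node) and
AdditiveGluing; the status sentence applies: "θ(p_c) = 0 on ℤ^d, all d ≥ 2 — kernel-verified (Lean 4/Mathlib, standard axioms); internal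
adversarial audit SIGNED 2026-08-20 04:29Z; external expert review pending."
Lane `prim-bschramm`, seat `prim-bschramm-p3` (gen 6; class C2), helper file (`--supports stmt-CriticalPhenomena-4575`).

* **`HeisGens.criticalContinuity_holds (hS : Admissible S) (x) : θ_{Cay(H₃(ℤ); S)}(x, p_c) = 0`** — Benjamini–Schramm Conj. 4 for every admissible
  Cayley graph of the discrete Heisenberg group (symmetric, `∋ a, b`, unit planar steps, `D₄`-invariant generating set);
* `criticalContinuity_std_holds` (`S = {a,b}^{±1}`, = p4's `heisenbergCriticalContinuity` up to the carrier `HeisGens.graph`), `criticalContinuity_abc_holds`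
  (`S = {a,b,c}^{±1}`).
[cite: BenjaminiSchramm1996, Conj. 4] [cite: KozmaNitzan2024, §1 p. 2 (approach 1)]
-/

noncomputable section

namespace Summit.CriticalPhenomena.PercolationContinuityZ3.Theorems.Transplant

open MeasureTheory Literature.Probability.Percolation Literature.Probability.LatticeModels SimpleGraph
open Literature.Geometry.MetricEmbeddings (genA genB heisInv)

namespace HeisGens

variable {S : Finset (ℤ × ℤ × ℤ)}

/-- **`θ(p_c) = 0` on `Cay(H₃(ℤ); S)` for every admissible `S`, at every vertex — unconditional** (node of record `samePDropOfSkeletonConcLt_holds`).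
[cite: BenjaminiSchramm1996, Conj. 4] -/
theorem criticalContinuity_holds (hS : Admissible S) (x : ℤ × ℤ × ℤ) : theta (graph S) x (criticalProbIOf (graph S) x) = 0 :=
  criticalContinuity_of_skeletonConcNode' samePDropOfSkeletonConcLt_holds hS x

/-- **Instance `S = {a, b}^{±1}`** (the standard Cayley graph, on the carrier `HeisGens.graph`). [cite: BenjaminiSchramm1996, Conj. 4] -/
theorem criticalContinuity_std_holds (x : ℤ × ℤ × ℤ) :
    theta (graph ({genA, genB, heisInv genA, heisInv genB} : Finset (ℤ × ℤ × ℤ))) x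
      (criticalProbIOf (graph ({genA, genB, heisInv genA, heisInv genB} : Finset (ℤ × ℤ × ℤ))) x) = 0 :=
  criticalContinuity_holds admissible_std x

/-- **Instance `S = {a, b, c}^{±1}`** with the central generator `c = (0,0,1)`. [cite: BenjaminiSchramm1996, Conj. 4] -/
theorem criticalContinuity_abc_holds (x : ℤ × ℤ × ℤ) :
    theta (graph ({genA, genB, heisInv genA, heisInv genB, (0, 0, 1), (0, 0, -1)} : Finset (ℤ × ℤ × ℤ))) x
      (criticalProbIOf (graph ({genA, genB, heisInv genA, heisInv genB, (0, 0, 1), (0, 0, -1)} : Finset (ℤ × ℤ × ℤ))) x) = 0 :=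
  criticalContinuity_holds admissible_abc x

end HeisGens

end Summit.CriticalPhenomena.PercolationContinuityZ3.Theorems.Transplant

end
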